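import Summits.KontsevichZagierPeriods.KontsevichZagierPeriods.Theorems.SoloBlindTetraSemialg
import HarnessLib

/-!
# The sporadic class at level 12: a cubic pull-back for `{2,3,7} ~ {1,2,9} ~ {2,2,8}`

At level `N = 12` the Deligne–Koblitz–Ogus equivalence of beta values has exactly one class of
the first kind that is NOT generated by the standard relations (reflection, Gauss
multiplication, the cyclic orbit) together with the tetrahedral class `{3,4,5} ~ {1,3,8} ~ {3,3,6}`
(`SoloBlindTetra`): in the notation `{12a, 12b, 12(1-a-b)}` it is

  `{1,4,7} ~ {2,4,6} ~ {4,4,4} ~ {2,2,8}`  versus  `{2,3,7} ~ {1,2,9}`,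

i.e. `B(1/6,1/6) / B(1/6,1/4) ∈ ℚ̄` is predicted by the conjecture but is invisible to the
one-variable Gauss/reflection calculus.  This file prepares a proof INSIDE the Kontsevich–Zagier
rules.  The mechanism is a degree-`3` rational map of `ℙ¹` with a triple point over `0`, a
double point over `1` and a triple point over `∞`,

  `F(W) = (P₀ - W)³ / (P₀³ (1 - W²))`,   `P₀ = √(2√3 - 3)`  (`P₀⁴ + 6P₀² = 3`),

whose two "miracles" (`sp_key1`, `sp_key2`)

  `P₀³(1 - W²) - (P₀ - W)³ = W (P₁ - W)²`,   `W² + 2P₀W - 3 = (W - P₁)(W + w₀)`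

(`P₁ = √3·P₀`, `w₀ = (2+√3)P₀ = √3/P₀`) make BOTH pull-backs

  `F^*(t^{-2/3}(1-t)^{-1/2} dt)` on `(0,P₀)` and `τ^*(t^{-2/3}(1-t)^{-5/6} dt)` on `(P₀,1)`,
  `τ = F/(F-1) = (W-P₀)³/(W(P₁-W)²)`,

equal to the SAME form `√P₀ · W^{-1/2}(1-W²)^{-5/6}(W + w₀) dW`; after `s = W²` the latter is
`(√P₀/2) s^{-1/4}(1-s)^{-5/6} ds + (√P₀ w₀/2) s^{-3/4}(1-s)^{-5/6} ds`.  Hence the three-term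
relation `B(1/3,1/2) + B(1/3,1/6) = (√P₀/2) B(3/4,1/6) + (√P₀w₀/2) B(1/4,1/6)` in the rules,
and with triplication/duplication (`SoloBlindTriplication`, `SoloBlindDuplication`) the merge
`β(1/6,1/4) ∝ β(1/6,1/6)` (`SoloBlindTwelveSporadic`).

This file: the constants `P₀, P₁, w₀` (all in `K₀ = ℚ̄ ∩ ℝ`) and their algebra, the maps `F`,
`τ` with derivatives, the two key identities, monotonicity, and the images
`F((0,P₀)) = (0,1)`, `τ((P₀,1)) = (0,1)`.

References: P. Deligne, *Valeurs de fonctions L et périodes d'intégrales*, Proc. Symp. Pure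
Math. 33 (1979) (with appendix by N. Koblitz and A. Ogus); N. Aoki, *Simple factors of the
Jacobian of a Fermat curve and the Picard number of a product of Fermat curves*, Amer. J. Math.
113 (1991); M. Kontsevich, D. Zagier, *Periods* (2001), §1.2.
-/

noncomputable section

open Set MeasureTheory MvPolynomial

namespace Summit.KontsevichZagierPeriods.KontsevichZagierPeriods.Theorems

namespace SoloBlind

open Literature.ModelTheory.ExponentialFields (IsSemialgebraic)
open Literature.NumberTheory.Transcendental
open Literature.NumberTheory.Transcendental.KZ

/-! ## The constants `P₀`, `P₁`, `w₀` -/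

/-- `2√3 - 3 > 0`. -/
theorem two_r3_sub_three_pos : 0 < 2 * r3 - 3 := by nlinarith [r3_sq, r3_pos]

/-- `P₀ = √(2√3 - 3) ≈ 0.68125`. -/
def sP0 : ℝ := Real.sqrt (2 * r3 - 3)

/-- `P₀² = 2√3 - 3`. -/
theorem sP0_sq : sP0 ^ 2 = 2 * r3 - 3 := Real.sq_sqrt two_r3_sub_three_pos.le

/-- `0 < P₀`. -/
theorem sP0_pos : 0 < sP0 := Real.sqrt_pos.mpr two_r3_sub_three_pos

/-- The minimal polynomial of `P₀`: `P₀⁴ = 3 - 6P₀²`. -/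
theorem sP0_quartic : sP0 ^ 4 = 3 - 6 * sP0 ^ 2 := by
  linear_combination (sP0 ^ 2 + 2 * r3 + 3) * sP0_sq + 4 * r3_sq

/-- `P₀ < 1`. -/
theorem sP0_lt_one : sP0 < 1 := by nlinarith [sP0_sq, r3_lt_two, sP0_pos]

/-- `P₀` is algebraic. -/
theorem isAlgebraic_sP0 : IsAlgebraic ℚ sP0 :=
  IsAlgebraic.of_pow two_pos
    (by rw [sP0_sq]; exact isAlgebraic_of_K₀ (2 * r3K - 3) (by push_cast; rfl))

/-- `P₀` as an element of `K₀`. -/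
def sP0K : K₀ := ⟨sP0, mem_K₀_iff.mpr isAlgebraic_sP0⟩

/-- `((P₀ : K₀) : ℝ) = P₀`. -/
@[simp] theorem coe_sP0K : ((sP0K : K₀) : ℝ) = sP0 := rfl

/-- `P₁ = √3 · P₀ ≈ 1.17996`, the double point of `F` over `∞` (outside `[0,1]`). -/
def sP1 : ℝ := r3 * sP0

/-- `P₁ = P₀(P₀²+3)/2` as a polynomial in `P₀`. -/
theorem sP1_eq : sP1 = sP0 * (sP0 ^ 2 + 3) / 2 := by
  unfold sP1; linear_combination (-sP0 / 2) * sP0_sq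

/-- `P₁² = 6√3 - 9`. -/
theorem sP1_sq : sP1 ^ 2 = 6 * r3 - 9 := by
  unfold sP1; linear_combination (sP0 ^ 2) * r3_sq + 3 * sP0_sq

/-- `1 < P₁`. -/
theorem one_lt_sP1 : 1 < sP1 := by
  have h0 : 0 < sP1 := mul_pos r3_pos sP0_pos
  have hr : 5 / 3 < r3 := by nlinarith [r3_sq, r3_pos]
  nlinarith [sP1_sq, h0, hr]

/-- `P₀ < P₁`. -/
theorem sP0_lt_sP1 : sP0 < sP1 := sP0_lt_one.trans one_lt_sP1

/-- `w₀ = (2+√3) P₀ ≈ 2.54246` (`= √3/P₀`), minus the third preimage of `∞` under `F'`. -/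
def sW0 : ℝ := (2 + r3) * sP0

/-- `w₀ = P₀(P₀²+7)/2` as a polynomial in `P₀`. -/
theorem sW0_eq : sW0 = sP0 * (sP0 ^ 2 + 7) / 2 := by
  unfold sW0; linear_combination (-sP0 / 2) * sP0_sq

/-- `0 < w₀`. -/
theorem sW0_pos : 0 < sW0 := mul_pos (by linarith [r3_pos]) sP0_pos

/-- `P₁` is algebraic. -/
theorem isAlgebraic_sP1 : IsAlgebraic ℚ sP1 :=
  isAlgebraic_of_K₀ (r3K * sP0K) (by push_cast; rfl)

/-- `w₀` is algebraic. -/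
theorem isAlgebraic_sW0 : IsAlgebraic ℚ sW0 :=
  isAlgebraic_of_K₀ ((2 + r3K) * sP0K) (by push_cast; rfl)

/-- `w₀` as an element of `K₀`. -/
def sW0K : K₀ := ⟨sW0, mem_K₀_iff.mpr isAlgebraic_sW0⟩

/-- `((w₀ : K₀) : ℝ) = w₀`. -/
@[simp] theorem coe_sW0K : ((sW0K : K₀) : ℝ) = sW0 := rfl

/-! ## The two key identities -/

/-- **First miracle:** `P₀³(1-W²) - (P₀-W)³ = W(P₁-W)²`, i.e. `1 - F = W(P₁-W)²/(P₀³(1-W²))`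
has a DOUBLE zero at `P₁`. -/
theorem sp_key1 (W : ℝ) : sP0 ^ 3 * (1 - W ^ 2) - (sP0 - W) ^ 3 = W * (sP1 - W) ^ 2 := by
  rw [sP1_eq]; linear_combination (-(W * sP0 ^ 2) / 4) * sP0_quartic

/-- **Second miracle:** `W² + 2P₀W - 3 = (W-P₁)(W+w₀)`, so `F'` factors through `(P₁-W)`. -/
theorem sp_key2 (W : ℝ) : W ^ 2 + 2 * sP0 * W - 3 = (W - sP1) * (W + sW0) := by
  rw [sP1_eq, sW0_eq]; linear_combination ((sP0 ^ 2 + 4) / 4) * sP0_quartic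

/-- Third identity (for `τ'`): `2WP₁ - 3P₀W + P₀P₁ = P₀³(W + w₀)`. -/
theorem sp_key3 (W : ℝ) : 2 * W * sP1 - 3 * sP0 * W + sP0 * sP1 = sP0 ^ 3 * (W + sW0) := by
  rw [sP1_eq, sW0_eq]; linear_combination (-(sP0 ^ 2) / 2) * sP0_quartic

/-! ## The maps `F` (on `(0,P₀)`) and `τ = F/(F-1)` (on `(P₀,1)`) -/

/-- `F(W) = (P₀-W)³/(P₀³(1-W²))`. -/
def spF (W : ℝ) : ℝ := (sP0 - W) ^ 3 / (sP0 ^ 3 * (1 - W ^ 2))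

/-- `F'(W) = -(P₀-W)²(P₁-W)(W+w₀)/(P₀³(1-W²)²)`. -/
def spF' (W : ℝ) : ℝ := -((sP0 - W) ^ 2 * (sP1 - W) * (W + sW0)) / (sP0 ^ 3 * (1 - W ^ 2) ^ 2)

/-- `τ(W) = (W-P₀)³/(W(P₁-W)²)` (`= F/(F-1)`). -/
def spT (W : ℝ) : ℝ := (W - sP0) ^ 3 / (W * (sP1 - W) ^ 2)

/-- `τ'(W) = P₀³(W-P₀)²(W+w₀)/(W²(P₁-W)³)`. -/
def spT' (W : ℝ) : ℝ := sP0 ^ 3 * (W - sP0) ^ 2 * (W + sW0) / (W ^ 2 * (sP1 - W) ^ 3)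

/-- The denominator of `F` is positive on `0 < W < 1`. -/
theorem spF_den_pos {W : ℝ} (h0 : 0 < W) (h1 : W < 1) : 0 < sP0 ^ 3 * (1 - W ^ 2) :=
  mul_pos (pow_pos sP0_pos 3) (by nlinarith)

/-- The denominator of `τ` is positive on `(0,1)`. -/
theorem spT_den_pos {W : ℝ} (h0 : 0 < W) (h1 : W < 1) : 0 < W * (sP1 - W) ^ 2 :=
  mul_pos h0 (pow_pos (by linarith [one_lt_sP1]) 2)

/-- `1 - F(W) = W(P₁-W)²/(P₀³(1-W²))`. -/
theorem one_sub_spF {W : ℝ} (h0 : 0 < W) (h1 : W < 1) :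
    1 - spF W = W * (sP1 - W) ^ 2 / (sP0 ^ 3 * (1 - W ^ 2)) := by
  have hD := (spF_den_pos h0 h1).ne'
  rw [eq_div_iff hD, sub_mul, one_mul, spF, div_mul_cancel₀ _ hD, sp_key1]

/-- `1 - τ(W) = P₀³(1-W²)/(W(P₁-W)²)`. -/
theorem one_sub_spT {W : ℝ} (h0 : 0 < W) (h1 : W < 1) :
    1 - spT W = sP0 ^ 3 * (1 - W ^ 2) / (W * (sP1 - W) ^ 2) := by
  have hD := (spT_den_pos h0 h1).ne'
  rw [eq_div_iff hD, sub_mul, one_mul, spT, div_mul_cancel₀ _ hD]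
  linear_combination (-1:ℝ) * sp_key1 W

/-- `F` maps `(0,P₀)` into `(0,1)`. -/
theorem spF_mem {W : ℝ} (hW : W ∈ Ioo 0 sP0) : spF W ∈ Ioo 0 1 := by
  have h1 : W < 1 := hW.2.trans sP0_lt_one
  have hD := spF_den_pos hW.1 h1
  refine ⟨div_pos (pow_pos (by linarith [hW.2]) 3) hD, ?_⟩
  have h := one_sub_spF hW.1 h1
  have : 0 < W * (sP1 - W) ^ 2 / (sP0 ^ 3 * (1 - W ^ 2)) := div_pos (spT_den_pos hW.1 h1) hD
  linarith

/-- `τ` maps `(P₀,1)` into `(0,1)`. -/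
theorem spT_mem {W : ℝ} (hW : W ∈ Ioo sP0 1) : spT W ∈ Ioo 0 1 := by
  have h0 : 0 < W := sP0_pos.trans hW.1
  have hD := spT_den_pos h0 hW.2
  refine ⟨div_pos (pow_pos (by linarith [hW.1]) 3) hD, ?_⟩
  have h := one_sub_spT h0 hW.2
  have : 0 < sP0 ^ 3 * (1 - W ^ 2) / (W * (sP1 - W) ^ 2) := div_pos (spF_den_pos h0 hW.2) hD
  linarith

/-- `F(0) = 1`. -/
theorem spF_zero : spF 0 = 1 := by
  have h : sP0 ^ 3 ≠ 0 := pow_ne_zero 3 sP0_pos.ne'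
  unfold spF
  rw [div_eq_one_iff_eq (by simpa using h)]
  ring

/-- `F(P₀) = 0`. -/
theorem spF_sP0 : spF sP0 = 0 := by simp [spF]

/-- `τ(P₀) = 0`. -/
theorem spT_sP0 : spT sP0 = 0 := by simp [spT]

/-- `τ(1) = 1` (the first miracle at `W = 1`: `(1-P₀)³ = (P₁-1)²`). -/
theorem spT_one : spT 1 = 1 := by
  have hD : (1:ℝ) * (sP1 - 1) ^ 2 ≠ 0 := by
    have : sP1 - 1 ≠ 0 := by linarith [one_lt_sP1]
    positivity
  unfold spT
  rw [div_eq_one_iff_eq hD]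
  linear_combination sp_key1 1

/-! ## Derivatives -/

/-- `F'` is the derivative of `F` (away from `W = ±1`). -/
theorem hasDerivAt_spF {W : ℝ} (hW : sP0 ^ 3 * (1 - W ^ 2) ≠ 0) :
    HasDerivAt spF (spF' W) W := by
  have hi : HasDerivAt (fun y : ℝ => sP0 - y) (-1) W := by
    simpa using (hasDerivAt_id W).const_sub sP0
  have h1 : HasDerivAt (fun y : ℝ => (sP0 - y) ^ 3) (3 * (sP0 - W) ^ 2 * (-1)) W := by
    simpa using hi.fun_pow 3
  have h2 : HasDerivAt (fun y : ℝ => sP0 ^ 3 * (1 - y ^ 2)) (sP0 ^ 3 * (-(2 * W))) W := by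
    simpa using ((hasDerivAt_pow 2 W).const_sub 1).const_mul (sP0 ^ 3)
  refine (h1.div h2 hW).congr_deriv ?_
  have hD2 : sP0 ^ 3 * (1 - W ^ 2) ^ 2 ≠ 0 := by
    have h' : 1 - W ^ 2 ≠ 0 := fun h => hW (by rw [h, mul_zero])
    exact mul_ne_zero (pow_ne_zero 3 sP0_pos.ne') (pow_ne_zero 2 h')
  unfold spF'
  rw [div_eq_div_iff (pow_ne_zero 2 hW) hD2]
  linear_combination (sP0 ^ 6 * (sP0 - W) ^ 2 * (1 - W ^ 2) ^ 2) * sp_key2 W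

/-- `τ'` is the derivative of `τ` (away from `W = 0, P₁`). -/
theorem hasDerivAt_spT {W : ℝ} (hW : W * (sP1 - W) ^ 2 ≠ 0) :
    HasDerivAt spT (spT' W) W := by
  have h1 : HasDerivAt (fun y : ℝ => (y - sP0) ^ 3) (3 * (W - sP0) ^ 2 * 1) W := by
    simpa using ((hasDerivAt_id W).sub_const sP0).fun_pow 3
  have hA : HasDerivAt (fun y : ℝ => (sP1 - y) ^ 2) (2 * (sP1 - W) * (-1)) W := by
    simpa using ((hasDerivAt_id W).const_sub sP1).fun_pow 2
  have h2 : HasDerivAt (fun y : ℝ => y * (sP1 - y) ^ 2)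
      (1 * (sP1 - W) ^ 2 + W * (2 * (sP1 - W) * (-1))) W := (hasDerivAt_id' W).mul hA
  refine (h1.div h2 hW).congr_deriv ?_
  have hW0 : W ≠ 0 := fun h => hW (by rw [h, zero_mul])
  have hB : sP1 - W ≠ 0 := fun h => hW (by rw [h]; ring)
  have hD2 : W ^ 2 * (sP1 - W) ^ 3 ≠ 0 := mul_ne_zero (pow_ne_zero 2 hW0) (pow_ne_zero 3 hB)
  unfold spT'
  rw [div_eq_div_iff (pow_ne_zero 2 hW) hD2]
  linear_combination (W ^ 2 * (W - sP0) ^ 2 * (sP1 - W) ^ 4) * sp_key3 W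

/-- `F' < 0` on `(0,1)` away from `P₀`; here on `(0,P₀)`. -/
theorem spF'_neg {W : ℝ} (hW : W ∈ Ioo 0 sP0) : spF' W < 0 := by
  have h1 : W < 1 := hW.2.trans sP0_lt_one
  have hA : 0 < sP0 - W := by linarith [hW.2]
  have hB : 0 < sP1 - W := by linarith [one_lt_sP1]
  have hm : 0 < W + sW0 := by linarith [hW.1, sW0_pos]
  have hW0 := hW.1
  have hq : 0 < 1 - W ^ 2 := by nlinarith
  unfold spF'
  rw [neg_div]
  exact neg_neg_of_pos (div_pos (mul_pos (mul_pos (pow_pos hA 2) hB) hm)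
    (mul_pos (pow_pos sP0_pos 3) (pow_pos hq 2)))

/-- `|F'(W)| = (P₀-W)²(P₁-W)(W+w₀)/(P₀³(1-W²)²)` on `(0,P₀)`. -/
theorem abs_spF' {W : ℝ} (hW : W ∈ Ioo 0 sP0) :
    |spF' W| = (sP0 - W) ^ 2 * (sP1 - W) * (W + sW0) / (sP0 ^ 3 * (1 - W ^ 2) ^ 2) := by
  rw [abs_of_neg (spF'_neg hW), spF', neg_div, neg_neg]

/-- `τ' > 0` on `(P₀,1)`. -/
theorem spT'_pos {W : ℝ} (hW : W ∈ Ioo sP0 1) : 0 < spT' W := by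
  have h0 : 0 < W := sP0_pos.trans hW.1
  have hA : 0 < W - sP0 := by linarith [hW.1]
  have hB : 0 < sP1 - W := by linarith [one_lt_sP1, hW.2]
  have hm : 0 < W + sW0 := by linarith [sW0_pos]
  unfold spT'
  exact div_pos (mul_pos (mul_pos (pow_pos sP0_pos 3) (pow_pos hA 2)) hm)
    (mul_pos (pow_pos h0 2) (pow_pos hB 3))

/-! ## Monotonicity, injectivity, images -/

/-- `F` is continuous on `[0,P₀]`. -/
theorem continuousOn_spF : ContinuousOn spF (Icc 0 sP0) := by
  refine ContinuousOn.div (by fun_prop) (by fun_prop) fun W hW => ?_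
  have : W ^ 2 < 1 := by nlinarith [hW.1, hW.2, sP0_lt_one, sP0_pos]
  exact mul_ne_zero (pow_ne_zero 3 sP0_pos.ne') (by linarith)

/-- `τ` is continuous on `[P₀,1]`. -/
theorem continuousOn_spT : ContinuousOn spT (Icc sP0 1) := by
  refine ContinuousOn.div (by fun_prop) (by fun_prop) fun W hW => ?_
  have h0 : 0 < W := sP0_pos.trans_le hW.1
  have hB : 0 < sP1 - W := by linarith [one_lt_sP1, hW.2]
  positivity

/-- `F` is strictly decreasing on `(0,P₀)`. -/
theorem strictAntiOn_spF : StrictAntiOn spF (Ioo 0 sP0) := by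
  refine strictAntiOn_of_deriv_neg (convex_Ioo 0 sP0)
    (continuousOn_spF.mono Ioo_subset_Icc_self) fun W hW => ?_
  rw [interior_Ioo] at hW
  rw [(hasDerivAt_spF (spF_den_pos hW.1 (hW.2.trans sP0_lt_one)).ne').deriv]
  exact spF'_neg hW

/-- `τ` is strictly increasing on `(P₀,1)`. -/
theorem strictMonoOn_spT : StrictMonoOn spT (Ioo sP0 1) := by
  refine strictMonoOn_of_deriv_pos (convex_Ioo sP0 1)
    (continuousOn_spT.mono Ioo_subset_Icc_self) fun W hW => ?_
  rw [interior_Ioo] at hW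
  rw [(hasDerivAt_spT (spT_den_pos (sP0_pos.trans hW.1) hW.2).ne').deriv]
  exact spT'_pos hW

/-- `F` is injective on `(0,P₀)`. -/
theorem injOn_spF : InjOn spF (Ioo 0 sP0) := strictAntiOn_spF.injOn

/-- `τ` is injective on `(P₀,1)`. -/
theorem injOn_spT : InjOn spT (Ioo sP0 1) := strictMonoOn_spT.injOn

/-- `F` maps `(0,P₀)` ONTO `(0,1)`. -/
theorem image_spF : Ioo (0:ℝ) 1 = spF '' Ioo 0 sP0 := by
  refine Subset.antisymm ?_ ?_
  · have h := intermediate_value_Ioo' sP0_pos.le continuousOn_spF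
    rwa [spF_sP0, spF_zero] at h
  · rintro t ⟨W, hW, rfl⟩
    exact spF_mem hW

/-- `τ` maps `(P₀,1)` ONTO `(0,1)`. -/
theorem image_spT : Ioo (0:ℝ) 1 = spT '' Ioo sP0 1 := by
  refine Subset.antisymm ?_ ?_
  · have h := intermediate_value_Ioo sP0_lt_one.le continuousOn_spT
    rwa [spT_sP0, spT_one] at h
  · rintro t ⟨W, hW, rfl⟩
    exact spT_mem hW

end SoloBlind

end Summit.KontsevichZagierPeriods.KontsevichZagierPeriods.Theorems
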